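import Literature.NumberTheory.LFunctions.SchoenfeldZeroSums
import Literature.NumberTheory.LFunctions.ZetaFirstZeroCertificate
import HarnessLib

/-!
# HANDOFF — the SECOND MOMENT of the zeros below a height, from COUNTING: `Σ_{0<γ≤T} m(ρ)γ² ≥ N(T)T² − T³/(3π)·(log(T/2πe) − 1/3) − s(T² − 196) − c₁₄` (rh-explicit, track «HANDOFF», seat prove-2 gen9, ATTEMPT-16 Lemma B2, kernel form per ATTEMPT-18 (D-2))

HONEST FRAMING. Nothing here bears on the truth of RH; this is zero COUNTING. In ATTEMPT-16 (HOME/handoff/prove-2/ATTEMPT-16.md §3)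
Lemma B2 bounds from below `D₁ = Σ_{k≤K}(γ_k² − ℓ_k²)`, the excess of the second moment of the killed zeros over that of the lattice,
by `T*³/(10π)`; the input is an Abel summation of `Σ γ_k²` against the counting function with `N ≤ N_sm + s`. Per ATTEMPT-18 (D-2) the
kernel kills the HEIGHT `T` (the multiset `zerosBetween 0 T`, all zeros with `0 < Im ρ ≤ T`, with multiplicity) rather than an index,
and then the tree's PARTIAL SUMMATION identity `SchoenfeldBound.sum_zerosBetween_eq` does the work. THIS FILE proves:

* `sum_sq_im_eq` — `Σ_{ρ ∈ zerosBetween 0 T} m(ρ)(Im ρ)² = N(T)·T² − ∫_0^T N(t)·2t dt` (`T ≥ 0`);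
* `hasDerivAt_smoothMomentPrim` — `G(t) = (t³/3π)(log(t/(2πe)) − 1/3)` has `G′(t) = (t²/π)·log(t/(2πe)) = 2t·N_sm(t)` (`t > 0`);
* **`sum_sq_im_ge`** — if `N(t) ≤ (t/2π)log(t/(2πe)) + s` for `14 ≤ t ≤ T` (any real `s`; e.g. the tree's
  `zetaZeroCount_hasanalizade_shen_wong_holds`), then
  `Σ_{ρ ∈ zerosBetween 0 T} m(ρ)(Im ρ)² ≥ N(T)·T² − (G(T) − G(14)) − s·(T² − 14²)`  (`T ≥ 14`, any real `s`; `N = 0` below `14` by `zetaZeroCount_fourteen`);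
* `sum_latticeSq_eq` — `Σ_{k=1}^{K} (πk/b)² = (π/b)²·K(K+1)(2K+1)/6`, the lattice's second moment, for the difference `D₁`.
No `sorry`, standard axioms, no definitions.

References: this track (ATTEMPT-16 §3 Lemma B2; ATTEMPT-18 §1 (D-2)). J. B. Rosser, L. Schoenfeld, Math. Comp. 29 (1975), Lemma 7
(partial summation against `N`; tree `SchoenfeldBound.sum_zerosBetween_eq`).
-/

set_option linter.dupNamespace false

noncomputable section

open Real Finset MeasureTheory Set intervalIntegral

namespace Summit.RiemannHypothesis.RiemannHypothesis.Theorems.Handoff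

open Literature.NumberTheory.LFunctions Literature.NumberTheory.LFunctions.SchoenfeldBound

/-! ## The second moment by partial summation -/

/-- **`Σ_{0 < γ ≤ T} m(ρ)γ² = N(T)T² − ∫_0^T 2t·N(t) dt`** (`T ≥ 0`). [cite: RosserSchoenfeld1975, Lemma 7] -/
theorem sum_sq_im_eq {T : ℝ} (hT : 0 ≤ T) :
    ∑ ρ ∈ zerosBetween 0 T, (riemannZetaZeroOrder ρ : ℝ) * ρ.im ^ 2 =
      (zetaZeroCount T : ℝ) * T ^ 2 - ∫ t in (0 : ℝ)..T, (zetaZeroCount t : ℝ) * (2 * t) := by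
  have h := sum_zerosBetween_eq (T₁ := 0) (T₂ := T) le_rfl hT (f := fun t : ℝ => t ^ 2) (f' := fun t : ℝ => 2 * t)
    (fun t _ => by simpa using hasDerivAt_pow 2 t) (by fun_prop)
  rw [h, zetaZeroCount_eq_zero_of_nonpos le_rfl]
  simp

/-- The primitive of `2t·N_sm(t) = (t²/π)log(t/(2πe))`: `G(t) = (t³/(3π))·(log(t/(2πe)) − 1/3)`, `G′ = (t²/π)log(t/(2πe))` for `t > 0`.
[folklore] -/
theorem hasDerivAt_smoothMomentPrim {t : ℝ} (ht : 0 < t) :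
    HasDerivAt (fun u : ℝ => u ^ 3 / (3 * π) * (Real.log (u / (2 * π * Real.exp 1)) - 1 / 3))
      (t ^ 2 / π * Real.log (t / (2 * π * Real.exp 1))) t := by
  have hc : (0 : ℝ) < 2 * π * Real.exp 1 := by positivity
  have h1 : HasDerivAt (fun u : ℝ => u ^ 3 / (3 * π)) (3 * t ^ 2 / (3 * π)) t := by
    simpa using (hasDerivAt_pow 3 t).div_const (3 * π)
  have h2 : HasDerivAt (fun u : ℝ => Real.log (u / (2 * π * Real.exp 1)) - 1 / 3) (1 / t) t := by
    have h3 : HasDerivAt (fun u : ℝ => u / (2 * π * Real.exp 1)) (1 / (2 * π * Real.exp 1)) t := by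
      simpa using (hasDerivAt_id t).div_const (2 * π * Real.exp 1)
    have h4 := (h3.log (by positivity : t / (2 * π * Real.exp 1) ≠ 0)).sub_const (1 / 3)
    refine h4.congr_deriv ?_
    field_simp
  refine (h1.mul h2).congr_deriv ?_
  field_simp
  ring

/-- **ATTEMPT-16 Lemma B2, kernel form (second moment from counting).** If `N(t) ≤ (t/2π)log(t/(2πe)) + s` on `[14, T]`
(`T ≥ 14`, any real `s`), then with `G(t) = (t³/3π)(log(t/(2πe)) − 1/3)`:
`Σ_{0<γ≤T} m(ρ)γ² ≥ N(T)T² − (G(T) − G(14)) − s(T² − 14²)`. [this track, ATTEMPT-16 Lemma B2] -/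
theorem sum_sq_im_ge {T s : ℝ} (hT : 14 ≤ T)
    (hN : ∀ t : ℝ, 14 ≤ t → t ≤ T → (zetaZeroCount t : ℝ) ≤ t / (2 * π) * Real.log (t / (2 * π * Real.exp 1)) + s) :
    (zetaZeroCount T : ℝ) * T ^ 2 -
        ((T ^ 3 / (3 * π) * (Real.log (T / (2 * π * Real.exp 1)) - 1 / 3) -
          (14 : ℝ) ^ 3 / (3 * π) * (Real.log (14 / (2 * π * Real.exp 1)) - 1 / 3)) + s * (T ^ 2 - 14 ^ 2)) ≤
      ∑ ρ ∈ zerosBetween 0 T, (riemannZetaZeroOrder ρ : ℝ) * ρ.im ^ 2 := by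
  rw [sum_sq_im_eq (by linarith)]
  -- integrability of `t ↦ N(t)·2t` on any interval
  have hint : ∀ a b : ℝ, IntervalIntegrable (fun t : ℝ => (zetaZeroCount t : ℝ) * (2 * t)) volume a b := by
    intro a b
    have h := intervalIntegrable_count_sub_mul (T₁ := 0) (a := a) (b := b) (g := fun t : ℝ => 2 * t) (by fun_prop)
    simpa [zetaZeroCount_eq_zero_of_nonpos le_rfl] using h
  -- split at `14`; the integral over `[0, 14]` vanishes
  rw [← integral_add_adjacent_intervals (hint 0 14) (hint 14 T)]
  have h0 : ∫ t in (0 : ℝ)..14, (zetaZeroCount t : ℝ) * (2 * t) = ∫ t in (0 : ℝ)..14, (0 : ℝ) := by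
    refine intervalIntegral.integral_congr fun t ht => ?_
    rw [Set.uIcc_of_le (by norm_num)] at ht
    have : zetaZeroCount t = 0 := by
      have h1 := zetaZeroCount_mono ht.2
      rw [zetaZeroCount_fourteen] at h1
      exact Nat.le_zero.1 h1
    simp [this]
  rw [intervalIntegral.integral_zero] at h0
  rw [h0, zero_add]
  -- on `[14, T]` compare with the smooth count
  have hcont : ContinuousOn (fun t : ℝ => (t / (2 * π) * Real.log (t / (2 * π * Real.exp 1)) + s) * (2 * t)) (Icc 14 T) := by
    refine ContinuousOn.mul (ContinuousOn.add (ContinuousOn.mul (by fun_prop)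
      (ContinuousOn.log (by fun_prop) fun x hx => ?_)) continuousOn_const) (by fun_prop)
    have : (0 : ℝ) < x := by linarith [hx.1]
    positivity
  have hint' : IntervalIntegrable (fun t : ℝ => (t / (2 * π) * Real.log (t / (2 * π * Real.exp 1)) + s) * (2 * t))
      volume 14 T := hcont.intervalIntegrable_of_Icc hT
  have hup : ∫ t in (14 : ℝ)..T, (zetaZeroCount t : ℝ) * (2 * t) ≤
      ∫ t in (14 : ℝ)..T, (t / (2 * π) * Real.log (t / (2 * π * Real.exp 1)) + s) * (2 * t) := by
    refine integral_mono_on hT (hint 14 T) hint' fun t ht => ?_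
    exact mul_le_mul_of_nonneg_right (hN t ht.1 ht.2) (by linarith [ht.1])
  have hderiv : ∀ t ∈ Set.uIcc 14 T, HasDerivAt
      (fun u : ℝ => u ^ 3 / (3 * π) * (Real.log (u / (2 * π * Real.exp 1)) - 1 / 3) + s * u ^ 2)
      ((t / (2 * π) * Real.log (t / (2 * π * Real.exp 1)) + s) * (2 * t)) t := by
    intro t ht
    rw [Set.uIcc_of_le hT] at ht
    have htpos : 0 < t := by linarith [ht.1]
    have ha := hasDerivAt_smoothMomentPrim htpos
    have hb : HasDerivAt (fun u : ℝ => s * u ^ 2) (s * (2 * t)) t := by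
      simpa using (hasDerivAt_pow 2 t).const_mul s
    refine (ha.add hb).congr_deriv ?_
    field_simp
  have hprim := integral_eq_sub_of_hasDerivAt hderiv hint'
  rw [hprim] at hup
  linarith

/-! ## The lattice's second moment -/

/-- `Σ_{k=1}^{K} k² = K(K+1)(2K+1)/6` (over `ℝ`). [folklore] -/
theorem sum_range_succ_sq (K : ℕ) :
    ∑ k ∈ Finset.range K, ((k + 1 : ℕ) : ℝ) ^ 2 = (K : ℝ) * (K + 1) * (2 * K + 1) / 6 := by
  induction K with
  | zero => simp
  | succ n ih =>
    rw [Finset.sum_range_succ, ih]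
    push_cast
    ring

/-- **The lattice's second moment**: `Σ_{k=1}^{K} (πk/b)² = (π/b)²·K(K+1)(2K+1)/6`. [this track, ATTEMPT-16 §3] -/
theorem sum_latticeSq_eq (b : ℝ) (K : ℕ) :
    ∑ k ∈ Finset.range K, (π * ((k + 1 : ℕ) : ℝ) / b) ^ 2 = (π / b) ^ 2 * ((K : ℝ) * (K + 1) * (2 * K + 1) / 6) := by
  rw [← sum_range_succ_sq, Finset.mul_sum]
  refine Finset.sum_congr rfl fun k _ => ?_
  ring

end Summit.RiemannHypothesis.RiemannHypothesis.Theorems.Handoff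

end
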